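import Summits.CriticalPhenomena.Ising3DConformalLimit.Theorems.ExistsScaleCovariantLimit.Negative.TightnessUniqueness
import Summits.CriticalPhenomena.Ising3DConformalLimit.Theorems.HyperoctahedralRPExistsScaleCovariantLimitCompactnessItemMapsDoubling
import Summits.CriticalPhenomena.Ising3DConformalLimit.Theorems.HyperoctahedralRPExistsScaleCovariantLimitFunnelDoublingIffAxisRate
import Summits.CriticalPhenomena.Ising3DConformalLimit.Theorems.HyperoctahedralRPExistsScaleCovariantLimitFoldedCurrentDefs
import Summits.CriticalPhenomena.Ising3DConformalLimit.Theorems.HyperoctahedralRPExistsScaleCovariantLimitFoldedCurrentWallRepulsionIffDoubling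
import Summits.CriticalPhenomena.Ising3DConformalLimit.Theorems.HyperoctahedralRPExistsScaleCovariantLimitFoldedCurrentIdentity
import Summits.CriticalPhenomena.Ising3DConformalLimit.Theorems.HyperoctahedralRPExistsScaleCovariantLimitFoldedCurrentEngineIffDoubling
import Summits.CriticalPhenomena.Ising3DConformalLimit.Theorems.HyperoctahedralRPExistsScaleCovariantLimitFoldedCurrentUniqueness
import Summits.CriticalPhenomena.Ising3DConformalLimit.Theses.GaussianScaleMixture
import Summits.CriticalPhenomena.Ising3DConformalLimit.Theses.PositivityBegetsConformality
import Summits.CriticalPhenomena.Ising3DConformalLimit.Theses.ClusterRigidity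
import HarnessLib

/-!
# Skeleton — crux `ExistsScaleCovariantLimit` (item stmt-CriticalPhenomena-1981), line `folded-current-repulsion` — v10 (lead c19, route MonotoneRG; stubs and composition byte-identical to v7–v9)

v1: crux-strategist `planner-cstrat-stmt-CriticalPhenomena-1981-p1-0` (2026-08-17; card `Lines/folded-current-repulsion.md`,
census `STRATEGY-CENSUS.md`). v2–v5: line lead c11 — reshape into the tree's reflected-current framework; F1 `stub_foldedIdentity` LANDED
(p138063); the engine certified: `wallRepulsion_iff_twoPointDoubling : WallRepulsion ↔ TwoPointDoubling` (p138231: F2 IS item 6150).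
v6 (this file): the wave-1 F4 worker REDUCED the uniqueness stub to the existing item stmt-CriticalPhenomena-4659
`ClusterRigidity.ClusterSetTotallyDisconnected` given the compactness half (`clusterPointUnique_of_orbitPrecompact_of_totallyDisconnected :
OrbitPrecompact → ClusterSetTotallyDisconnected → ClusterPointUnique`, file `Theorems/…FoldedCurrentUniqueness.lean`; also `crux ⟺ 6150 ∧ 4659`),
so the skeleton is RESHAPED: the second registered stub is now item 4659 VERBATIM (`stub_clusterSetTotallyDisconnected`), and the composition
feeds it `OrbitPrecompact` obtained from F2 (6150 ⟺ 5955, p120504). BOTH open stubs are existing ledger items: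
F2 `stub_wallRepulsion` = item 6150, F4' `stub_clusterSetTotallyDisconnected` = item 4659. Everything else is landed.
v7 (line lead c15, route re-audit of `PositivityBegetsConformality`): stubs and composition UNCHANGED; adds
`ExistsScaleCovariantLimit_proof_pbc`, concluding route PositivityBegetsConformality's copy of the shared decl BY NAME
(the three route `def`s have the same body; the HyperoctahedralRP proof term is accepted at each by `δ`-unfolding).

v8 (line lead c17): stubs and composition byte-identical to v7. Recorded alongside (all `--supports 1981`): the three
crux-strategist split stubs at route MonotoneRG's copy (`MonotoneRGSplit.ExistsScaleCovariantLimit_{of,iff}_subs`,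
`subs_of_existsScaleCovariantLimit`, p154720), the standalone HRP split glue `SplitGlue.hrp_crux_of_doubling_of_totallyDisconnected`
(p154899), and the F2 record "the critical axis profile is COMPLETELY MONOTONE" (`HankelMoment.completelyMonotone_of_hankel_psd`,
p153968; Ising instance `criticalAxis_completelyMonotone`).

v9 (line lead c18, 2026-08-17T11:4xZ): stubs and composition byte-identical to v8; re-registered from a live path after the
re-seat trigger (status change of items 6150 / 4659 / 6153) was checked and found NOT fired (all three open, unclaimed).
c18's registered sub-goals §5–§8 (order-two dictionary, scale-covariance rigidity, η from PointwiseLimitTwo) LANDED as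
p158992 / p159467 / p160012 / p160474 and are removed from the skeleton.

v10 (line lead c19, 2026-08-17T18:5xZ, route re-audit of `MonotoneRG`, where item 1981 is the TARGET, rank 0): stubs and composition
byte-identical to v7–v9; adds `ExistsScaleCovariantLimit_proof_mrg`, concluding route MonotoneRG's copy of the shared decl BY NAME;
trigger re-checked 18:4xZ: items 6150 / 4659 / 6153 all open, unclaimed (6150 and 4659 now run their own strategist lines:
`Cruxes/TwoPointDoubling/Lines/{curvature_split,superharmonic_comparison}.lean`, `Cruxes/ClusterSetTotallyDisconnected/Lines/cluster_light_cone.lean`).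

## Shape (2 registered stubs + kernel-checked composition)

* F2 `stub_wallRepulsion : WallRepulsion` — THE ENGINE (= item 6150; research).
* F4' `stub_clusterSetTotallyDisconnected : ClusterRigidity.ClusterSetTotallyDisconnected` — the identification half (= item 4659; open).
* `ExistsScaleCovariantLimit_of : WallRepulsion → ClusterSetTotallyDisconnected → crux` for BOTH route copies of the shared decl.
-/

noncomputable section

open Filter Topology Finset
open scoped BigOperators symmDiff ENNReal
open Literature.Probability.LatticeModels
open Summit.CriticalPhenomena.Ising3DConformalLimit.MoebiusLimitExistsOnlyInteraction (rhoPin IsClusterPoint)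
open Summit.CriticalPhenomena.Ising3DConformalLimit.Theses
open Classical

namespace Summit.CriticalPhenomena.Ising3DConformalLimit.Cruxes.ExistsScaleCovariantLimit.FoldedCurrentRepulsion

/-! ## §3 Registered stubs (v6) -/

/-- **F2** (THE ENGINE = item stmt-CriticalPhenomena-6150; research). -/
theorem stub_wallRepulsion : WallRepulsion := by
  sorry

/-- **F4'** (the identification half = item stmt-CriticalPhenomena-4659 verbatim; open). -/
theorem stub_clusterSetTotallyDisconnected : ClusterRigidity.ClusterSetTotallyDisconnected := by
  sorry

/-! ## §4 Composition — the crux BY NAME -/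

/-- **COMPOSITION (v6).** `WallRepulsion → ClusterSetTotallyDisconnected → ExistsScaleCovariantLimit`: F2 is item 6150
(`wallRepulsion_iff_twoPointDoubling`, p138231), 6150 is `MonotoneRG.OrbitPrecompact` (`TwoHierarchies.ItemMaps.orbitPrecompact_iff_doubling`,
p120504), compactness + total disconnectedness of the cluster set give uniqueness of the cluster point
(`clusterPointUnique_of_orbitPrecompact_of_totallyDisconnected`, F4 worker), and compactness + uniqueness is the crux
(`ExistsScaleCovariantLimitNegative.crux_iff_orbitPrecompact_and_unique`, p78620). -/
theorem ExistsScaleCovariantLimit_of :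
    WallRepulsion → ClusterRigidity.ClusterSetTotallyDisconnected →
      Summit.CriticalPhenomena.Ising3DConformalLimit.Theses.HyperoctahedralRP.ExistsScaleCovariantLimit := by
  intro h2 h4
  have hP : MonotoneRG.OrbitPrecompact :=
    TwoHierarchies.ItemMaps.orbitPrecompact_iff_doubling.2 (wallRepulsion_iff_twoPointDoubling.1 h2)
  exact ExistsScaleCovariantLimitNegative.crux_iff_orbitPrecompact_and_unique.2
    ⟨hP, clusterPointUnique_of_orbitPrecompact_of_totallyDisconnected hP h4⟩

/-- The crux from the registered stubs (closed modulo exactly `stub_wallRepulsion` = item 6150 and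
`stub_clusterSetTotallyDisconnected` = item 4659), route HyperoctahedralRP's copy of the shared decl. -/
theorem ExistsScaleCovariantLimit_proof :
    Summit.CriticalPhenomena.Ising3DConformalLimit.Theses.HyperoctahedralRP.ExistsScaleCovariantLimit :=
  ExistsScaleCovariantLimit_of stub_wallRepulsion stub_clusterSetTotallyDisconnected

/-- The same, for route GaussianScaleMixture's copy of the shared decl (the two `def`s have the same body). -/
theorem ExistsScaleCovariantLimit_proof_gsm :
    Summit.CriticalPhenomena.Ising3DConformalLimit.Theses.GaussianScaleMixture.ExistsScaleCovariantLimit :=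
  ExistsScaleCovariantLimit_proof

/-- The same, for route PositivityBegetsConformality's copy of the shared decl (item stmt-CriticalPhenomena-1981 is
crux #4 `(E₀)` of that route; its `def` has the same body as HyperoctahedralRP's). -/
theorem ExistsScaleCovariantLimit_proof_pbc :
    Summit.CriticalPhenomena.Ising3DConformalLimit.Theses.PositivityBegetsConformality.ExistsScaleCovariantLimit :=
  ExistsScaleCovariantLimit_proof


/-- The same, for route MonotoneRG's copy of the shared decl (item stmt-CriticalPhenomena-1981 is the TARGET, rank 0, of
that route; its `def` has the same body as HyperoctahedralRP's; `Theses.MonotoneRG` is in the import closure through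
`Negative.TightnessUniqueness`). -/
theorem ExistsScaleCovariantLimit_proof_mrg :
    Summit.CriticalPhenomena.Ising3DConformalLimit.Theses.MonotoneRG.ExistsScaleCovariantLimit :=
  ExistsScaleCovariantLimit_proof

end Summit.CriticalPhenomena.Ising3DConformalLimit.Cruxes.ExistsScaleCovariantLimit.FoldedCurrentRepulsion

end
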